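import Mathlib
import Literature.Computability.AlgebraicComplexity.LocalStrongUSP

-- `Summit.MatrixMultiplication.MatrixMultiplication.…` (summit = problem name) trips `dupNamespace` on every decl.
set_option linter.dupNamespace false

/-!
# Re-indexing a concatenated code along `Fin m × Fin b ≃ Fin (7k)` (stub `stub_transport`, line `Concat`)

Stub `stub_transport` of the line `Concat` (graded tilted alphabets) for the crux
`Summit.MatrixMultiplication.MatrixMultiplication.Theses.ThinBlockAlpha.SkewLocalStrongUSP`.

The line produces rows as CONCATENATIONS of letters: an alphabet `e : Fin N → Fin b → Fin 3`, a code
`W` of words `ω : Fin m → Fin N`, the row of `ω` being `p : Fin m × Fin b ↦ e (ω p.1) p.2`, with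
`m * b = 7 * k`.  This file is the pure bookkeeping step: transport every row along the equivalence
`ε : Fin m × Fin b ≃ Fin (m * b) ≃ Fin (7 * k)` (`finProdFinEquiv`, `finCongr`), i.e.
`row ω i := e (ω (ε⁻¹ i).1) (ε⁻¹ i).2`, and take `U := W.image row`.

* the witness clause survives: members of `U` are `row ωᵢ` with `ωᵢ ∈ W`; distinct rows come from
  distinct words; the admissible position `p` of the word-triple becomes the coordinate `ε p`, and the
  tree's pattern set `localStrongUSPPatterns` IS the literal six-element finset of the crux;
* the class clause survives: the number of coordinates `i` with `row ω i = a` is the number of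
  positions `p` with `e (ω p.1) p.2 = a` (`Finset.card_equiv ε`);
* `|U| = |W|`: `row` is injective because the letters are (`Function.Injective e`).

Only Mathlib and the tree's `localStrongUSPPatterns`; no named facts.
-/

namespace Summit.MatrixMultiplication.MatrixMultiplication.Theorems.SkewLocalStrongUSP

open Finset
open Literature.Computability.AlgebraicComplexity (localStrongUSPPatterns)

/-- **stub_transport** (line `Concat`) — re-indexing bookkeeping: an injectively-lettered code `W`
with the witness property and the class laws (`3k` zeros, `k` ones) at width `m * b = 7 * k`, read
through `Fin m × Fin b ≃ Fin (7 * k)`, is a family `U` of rows `Fin (7 * k) → Fin 3` of the crux's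
shape — witness clause over the literal six-pattern finset, exactly `3k` zeros and `k` ones per
row — with `|U| = |W|`.  Construction: `U := W.image row`,
`row ω i := e (ω (ε⁻¹ i).1) (ε⁻¹ i).2`, `ε := finProdFinEquiv.trans (finCongr h)`. -/
theorem stub_transport :
    ∀ (k m b N : ℕ), m * b = 7 * k → ∀ (e : Fin N → Fin b → Fin 3) (W : Finset (Fin m → Fin N)),
      Function.Injective e →
      (∀ ω₁ ∈ W, ∀ ω₂ ∈ W, ∀ ω₃ ∈ W, (ω₁ ≠ ω₂ ∨ ω₂ ≠ ω₃) →
        ∃ p : Fin m × Fin b, (e (ω₁ p.1) p.2, e (ω₂ p.1) p.2, e (ω₃ p.1) p.2) ∈ localStrongUSPPatterns) →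
      (∀ ω ∈ W, (univ.filter fun p : Fin m × Fin b => e (ω p.1) p.2 = 0).card = 3 * k ∧
        (univ.filter fun p : Fin m × Fin b => e (ω p.1) p.2 = 1).card = k) →
      ∃ U : Finset (Fin (7 * k) → Fin 3),
        (∀ u ∈ U, ∀ v ∈ U, ∀ w ∈ U, (u ≠ v ∨ v ≠ w) → ∃ i, (u i, v i, w i) ∈
          ({((0 : Fin 3), (1 : Fin 3), (0 : Fin 3)), (0, 1, 1), (0, 0, 2), (0, 2, 2), (1, 1, 2), (2, 1, 2)} :
            Finset (Fin 3 × Fin 3 × Fin 3))) ∧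
        (∀ u ∈ U, (univ.filter fun i => u i = 0).card = 3 * k ∧
          (univ.filter fun i => u i = 1).card = k) ∧
        U.card = W.card := by
  intro k m b N h e W he hwit hclass
  -- the re-indexing equivalence `Fin m × Fin b ≃ Fin (m * b) ≃ Fin (7 * k)`
  set ε : Fin m × Fin b ≃ Fin (7 * k) := finProdFinEquiv.trans (finCongr h)
  -- the transported row of a word
  set row : (Fin m → Fin N) → Fin (7 * k) → Fin 3 :=
    fun ω i => e (ω (ε.symm i).1) (ε.symm i).2 with hrow_def
  -- evaluating the transported row at `ε p` returns the entry at position `p`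
  have happly : ∀ (ω : Fin m → Fin N) (p : Fin m × Fin b), row ω (ε p) = e (ω p.1) p.2 := by
    intro ω p
    simp only [hrow_def, Equiv.symm_apply_apply]
  -- counting a letter value in a transported row is counting it over the positions
  have hcount : ∀ (ω : Fin m → Fin N) (a : Fin 3), (univ.filter fun i => row ω i = a).card =
      (univ.filter fun p : Fin m × Fin b => e (ω p.1) p.2 = a).card := by
    intro ω a
    symm
    refine Finset.card_equiv ε fun p => ?_
    simp only [Finset.mem_filter, Finset.mem_univ, true_and, happly]
  -- distinct words have distinct rows (the letters are injective)
  have hinj : Function.Injective row := by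
    intro ω ω' hωω'
    funext j
    refine he (funext fun c => ?_)
    have h' := congrFun hωω' (ε (j, c))
    simpa only [happly] using h'
  refine ⟨W.image row, ?_, ?_, ?_⟩
  · -- witness clause
    intro u hu v hv w hw hne
    obtain ⟨ω₁, h₁, rfl⟩ := Finset.mem_image.1 hu
    obtain ⟨ω₂, h₂, rfl⟩ := Finset.mem_image.1 hv
    obtain ⟨ω₃, h₃, rfl⟩ := Finset.mem_image.1 hw
    have hne' : ω₁ ≠ ω₂ ∨ ω₂ ≠ ω₃ :=
      hne.imp (fun hn heq => hn (congrArg row heq)) (fun hn heq => hn (congrArg row heq))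
    obtain ⟨p, hp⟩ := hwit ω₁ h₁ ω₂ h₂ ω₃ h₃ hne'
    refine ⟨ε p, ?_⟩
    simp only [happly]
    exact hp
  · -- class clause
    intro u hu
    obtain ⟨ω, hω, rfl⟩ := Finset.mem_image.1 hu
    obtain ⟨h0, h1⟩ := hclass ω hω
    exact ⟨(hcount ω 0).trans h0, (hcount ω 1).trans h1⟩
  · -- cardinality
    exact Finset.card_image_of_injective W hinj

end Summit.MatrixMultiplication.MatrixMultiplication.Theorems.SkewLocalStrongUSP
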